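import Literature.Analysis.FluidPDE.BiotSavartNewtonKernel
import Literature.Analysis.FluidPDE.NewtonPotentialHolder
import Literature.Analysis.Convolution.YoungInequality
import HarnessLib

/-!
# Scale-invariant `L^q` bounds for the gradient-Newtonian potential of a density dominated by
# `R⁻¹|u|` on the ball `B(0, 2R)`

Analysis/FluidPDE support file (theorems only) for the discharge of the named fact
`Literature.Analysis.FluidPDE.bradshawTsai2017_lemma_2_5` (`PeriodicLerayExistence.lean`;
Bradshaw–Tsai, Ann. Henri Poincaré 18 (2017) = arXiv:1510.07504 [BT1], Lemma 2.5). There the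
divergence correction is `w = −∫ (∇ξ_R·U₀)(z) ∇Γ(· − z) dz` with `|∇ξ_R| ≲ R⁻¹` supported in
`R ≤ |z| ≤ 2R`, and the printed proof bounds `‖w‖_{L^q} ≤ c_q ‖ξU₀‖_{L^q}` by the Calderón–Zygmund
theory. This file proves the bound that is actually needed, with a constant independent of the
scale `R`, by Young's inequality instead (tree: `Literature.Analysis.Convolution`): writing
`|∇Γ| ≤ (4π)⁻¹|z|⁻² = (4π)⁻¹(K₁ + K₂)` with `K₁ = 1_{|z|<R}|z|⁻² ∈ L¹` (`‖K₁‖₁ = 4πR`) and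
`K₂ = 1_{|z|≥R}|z|⁻² ∈ L^q` (`‖K₂‖_q ∼ R^{3/q-2}`, `q > 3/2`),

  `‖∫ φ(z) ∇Γ(· − z) dz‖_q ≤ (4πR)⁻¹ (‖K₁‖₁ ‖u‖_q + ‖K₂‖_q ‖u‖₁) ≤ C_q ‖u‖_q`

whenever `|φ| ≤ R⁻¹|u|` with `u` vanishing off `B(0, 2R)` (`‖u‖₁ ≤ |B_{2R}|^{1-1/q} ‖u‖_q`); the
powers of `R` cancel (`exists_eLpNorm_potential_le`, all `2 ≤ q ≤ ∞`).

## References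

* Z. Bradshaw, T.-P. Tsai, Ann. Henri Poincaré 18 (2017) = arXiv:1510.07504, proof of Lemma 2.5
  [BradshawTsai2017AHP].
* J. C. Robinson, J. L. Rodrigo, W. Sadowski, *The Three-Dimensional Navier–Stokes Equations*
  (CUP 2016), Thm. A.10 (Young's inequality). [RobinsonRodrigoSadowskiCUP2016]
-/

noncomputable section

open MeasureTheory Set Filter Topology Function Metric InnerProductSpace
open scoped ENNReal NNReal RealInnerProductSpace

namespace Literature.Analysis.FluidPDE

namespace NewtonGradPotential

open NewtonPotentialHolder Literature.Analysis.Convolution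

/-! ### The kernel majorant `|z|⁻²` and its two pieces -/

/-- `‖∇Γ(z)‖ₑ ≤ (4π)⁻¹ |z|⁻²` in `ℝ≥0∞`. [folklore] -/
theorem enorm_gradient_newtonKernel_le (z : EuclideanSpace ℝ (Fin 3)) :
    ‖gradient newtonKernel z‖ₑ ≤
      ENNReal.ofReal (4 * Real.pi)⁻¹ * ENNReal.ofReal (‖z‖ ^ (-(2 : ℝ))) := by
  rw [← ENNReal.ofReal_mul (by positivity), ← ofReal_norm]
  refine ENNReal.ofReal_le_ofReal ?_
  rw [gradient, LinearIsometryEquiv.norm_map]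
  refine (norm_fderiv_newtonKernel_le z).trans (le_of_eq ?_)
  rw [Real.rpow_neg (norm_nonneg _), show (2 : ℝ) = ((2 : ℕ) : ℝ) by norm_num,
    Real.rpow_natCast, mul_inv]

/-- The majorant `z ↦ |z|⁻²` (as an `ℝ≥0∞`-valued function) is measurable. [folklore] -/
theorem measurable_kernelMajorant :
    Measurable fun z : EuclideanSpace ℝ (Fin 3) => ENNReal.ofReal (‖z‖ ^ (-(2 : ℝ))) :=
  (continuous_norm.measurable.pow_const _).ennreal_ofReal

/-- `∫ 1_{|z|<R} |z|⁻² dz = 3|B₁| R`. [folklore] -/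
theorem lintegral_indicator_ball_kernelMajorant {R : ℝ} (hR : 0 < R) :
    ∫⁻ z, (ball (0 : EuclideanSpace ℝ (Fin 3)) R).indicator
        (fun z => ENNReal.ofReal (‖z‖ ^ (-(2 : ℝ)))) z =
      ENNReal.ofReal (3 * (volume : Measure (EuclideanSpace ℝ (Fin 3))).real (ball 0 1) * R) := by
  rw [lintegral_indicator measurableSet_ball, lintegral_ball_norm_rpow_neg (by norm_num) hR]
  congr 1
  rw [show (3 : ℝ) - 2 = 1 by norm_num, Real.rpow_one, div_one]

/-- `∫ (1_{|z|≥R} |z|⁻²)^p dz = 3|B₁| R^{3-2p}/(2p-3)` for `p > 3/2`. [folklore] -/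
theorem lintegral_indicator_compl_ball_kernelMajorant_rpow {R p : ℝ} (hR : 0 < R)
    (hp : 3 / 2 < p) :
    ∫⁻ z, ((ball (0 : EuclideanSpace ℝ (Fin 3)) R)ᶜ.indicator
        (fun z => ENNReal.ofReal (‖z‖ ^ (-(2 : ℝ)))) z) ^ p =
      ENNReal.ofReal (3 * (volume : Measure (EuclideanSpace ℝ (Fin 3))).real (ball 0 1) *
        (R ^ (3 - 2 * p) / (2 * p - 3))) := by
  have hp0 : 0 < p := by linarith
  have hpt : ∀ z : EuclideanSpace ℝ (Fin 3), ((ball (0 : EuclideanSpace ℝ (Fin 3)) R)ᶜ.indicator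
      (fun z => ENNReal.ofReal (‖z‖ ^ (-(2 : ℝ)))) z) ^ p =
      (ball (0 : EuclideanSpace ℝ (Fin 3)) R)ᶜ.indicator
        (fun z => ENNReal.ofReal (‖z‖ ^ (-(2 * p)))) z := by
    intro z
    by_cases hz : z ∈ (ball (0 : EuclideanSpace ℝ (Fin 3)) R)ᶜ
    · rw [indicator_of_mem hz, indicator_of_mem hz,
        ENNReal.ofReal_rpow_of_nonneg (Real.rpow_nonneg (norm_nonneg _) _) hp0.le,
        ← Real.rpow_mul (norm_nonneg _), neg_mul]
    · rw [indicator_of_notMem hz, indicator_of_notMem hz, ENNReal.zero_rpow_of_pos hp0]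
  simp_rw [hpt]
  rw [lintegral_indicator measurableSet_ball.compl,
    lintegral_compl_ball_norm_rpow_neg (by linarith) hR]

/-- **`L¹` by `L^p` on a ball**: if `u` vanishes off `B(0, ρ)` then
`∫ |u| ≤ ‖u‖_p |B(0,ρ)|^{1/p'}` for conjugate exponents `p, p'` (Hölder). [folklore] -/
theorem lintegral_enorm_le_of_eq_zero_off_ball {E' : Type*} [NormedAddCommGroup E']
    {u : EuclideanSpace ℝ (Fin 3) → E'} (hu : AEStronglyMeasurable u volume) {ρ : ℝ}
    (hu0 : ∀ z, ρ ≤ ‖z‖ → u z = 0) {p p' : ℝ} (hpp' : p.HolderConjugate p') :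
    ∫⁻ z, ‖u z‖ₑ ≤ (∫⁻ z, ‖u z‖ₑ ^ p) ^ (1 / p) *
      (volume (ball (0 : EuclideanSpace ℝ (Fin 3)) ρ)) ^ (1 / p') := by
  have hp' : 0 < p' := hpp'.symm.pos
  set g : EuclideanSpace ℝ (Fin 3) → ℝ≥0∞ := (ball (0 : EuclideanSpace ℝ (Fin 3)) ρ).indicator
    fun _ => 1 with hg
  have hgm : Measurable g := measurable_const.indicator measurableSet_ball
  have h1 : ∫⁻ z, ‖u z‖ₑ = ∫⁻ z, ‖u z‖ₑ * g z := by
    refine lintegral_congr fun z => ?_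
    by_cases hz : z ∈ ball (0 : EuclideanSpace ℝ (Fin 3)) ρ
    · rw [hg, indicator_of_mem hz, mul_one]
    · rw [hu0 z (not_lt.1 (by rwa [mem_ball_zero_iff] at hz)), enorm_zero, zero_mul]
  have h2 : ∫⁻ z, g z ^ p' = volume (ball (0 : EuclideanSpace ℝ (Fin 3)) ρ) := by
    have : (fun z => g z ^ p') = g := by
      funext z
      by_cases hz : z ∈ ball (0 : EuclideanSpace ℝ (Fin 3)) ρ
      · rw [hg, indicator_of_mem hz, ENNReal.one_rpow]
      · rw [hg, indicator_of_notMem hz, ENNReal.zero_rpow_of_pos hp']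
    rw [this, hg, lintegral_indicator measurableSet_ball, setLIntegral_const, one_mul]
  rw [h1, ← h2]
  exact ENNReal.lintegral_mul_le_Lp_mul_Lq volume hpp' hu.enorm hgm.aemeasurable

/-! ### The pointwise majorisation of the potential -/

/-- **Pointwise bound**: if `|φ| ≤ R⁻¹|u|` then
`‖∫ φ(z) ∇Γ(y − z) dz‖ ≤ (4πR)⁻¹ ∫ |y − z|⁻² |u(z)| dz` (in `ℝ≥0∞`). [folklore] -/
theorem enorm_potential_le {E' : Type*} [NormedAddCommGroup E'] {R : ℝ} (hR : 0 < R)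
    {φ : EuclideanSpace ℝ (Fin 3) → ℝ} {u : EuclideanSpace ℝ (Fin 3) → E'}
    (hφu : ∀ z, |φ z| ≤ R⁻¹ * ‖u z‖) (y : EuclideanSpace ℝ (Fin 3)) :
    ‖∫ z, φ z • gradient newtonKernel (y - z)‖ₑ ≤
      ENNReal.ofReal ((4 * Real.pi)⁻¹ * R⁻¹) *
        ∫⁻ z, ENNReal.ofReal (‖y - z‖ ^ (-(2 : ℝ))) * ‖u z‖ₑ := by
  refine (enorm_integral_le_lintegral_enorm _).trans ?_
  rw [← lintegral_const_mul' _ _ ENNReal.ofReal_ne_top]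
  refine lintegral_mono fun z => ?_
  rw [enorm_smul]
  have h1 : ‖φ z‖ₑ ≤ ENNReal.ofReal R⁻¹ * ‖u z‖ₑ := by
    rw [← ofReal_norm, ← ofReal_norm, ← ENNReal.ofReal_mul (by positivity),
      Real.norm_eq_abs]
    exact ENNReal.ofReal_le_ofReal (hφu z)
  calc ‖φ z‖ₑ * ‖gradient newtonKernel (y - z)‖ₑ
      ≤ (ENNReal.ofReal R⁻¹ * ‖u z‖ₑ) *
          (ENNReal.ofReal (4 * Real.pi)⁻¹ * ENNReal.ofReal (‖y - z‖ ^ (-(2 : ℝ)))) :=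
        mul_le_mul' h1 (enorm_gradient_newtonKernel_le _)
    _ = ENNReal.ofReal ((4 * Real.pi)⁻¹ * R⁻¹) *
          (ENNReal.ofReal (‖y - z‖ ^ (-(2 : ℝ))) * ‖u z‖ₑ) := by
        rw [ENNReal.ofReal_mul (by positivity)]
        ring

/-- Splitting the majorant at radius `R`:
`∫ |y−z|⁻²|u(z)| dz = ∫ K₁(y−z)|u(z)| dz + ∫ K₂(y−z)|u(z)| dz`. [folklore] -/
theorem lintegral_kernelMajorant_mul_eq_add {E' : Type*} [NormedAddCommGroup E'] (R : ℝ)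
    {u : EuclideanSpace ℝ (Fin 3) → E'} (hu : AEStronglyMeasurable u volume)
    (y : EuclideanSpace ℝ (Fin 3)) :
    ∫⁻ z, ENNReal.ofReal (‖y - z‖ ^ (-(2 : ℝ))) * ‖u z‖ₑ =
      (∫⁻ z, (ball (0 : EuclideanSpace ℝ (Fin 3)) R).indicator
          (fun z => ENNReal.ofReal (‖z‖ ^ (-(2 : ℝ)))) (y - z) * ‖u z‖ₑ) +
      ∫⁻ z, (ball (0 : EuclideanSpace ℝ (Fin 3)) R)ᶜ.indicator
          (fun z => ENNReal.ofReal (‖z‖ ^ (-(2 : ℝ)))) (y - z) * ‖u z‖ₑ := by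
  have hm : AEMeasurable (fun z => (ball (0 : EuclideanSpace ℝ (Fin 3)) R).indicator
      (fun z => ENNReal.ofReal (‖z‖ ^ (-(2 : ℝ)))) (y - z) * ‖u z‖ₑ) volume :=
    ((measurable_kernelMajorant.indicator measurableSet_ball).comp
      (measurable_const.sub measurable_id)).aemeasurable.mul hu.enorm
  rw [← lintegral_add_left' hm]
  refine lintegral_congr fun z => ?_
  rw [← add_mul]
  congr 1
  exact (congrFun (indicator_self_add_compl (ball (0 : EuclideanSpace ℝ (Fin 3)) R)
    (fun z => ENNReal.ofReal (‖z‖ ^ (-(2 : ℝ))))) (y - z)).symm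

/-! ### The `L^q` bound for finite `q` -/

/-- The split potentials `y ↦ ∫ 1_S(y−z)|y−z|⁻²|u(z)| dz` are a.e.-measurable. [folklore] -/
theorem aemeasurable_lintegral_indicator_kernelMajorant {E' : Type*} [NormedAddCommGroup E']
    {u : EuclideanSpace ℝ (Fin 3) → E'} (hu : AEStronglyMeasurable u volume)
    {S : Set (EuclideanSpace ℝ (Fin 3))} (hS : MeasurableSet S) :
    AEMeasurable (fun y => ∫⁻ z, S.indicator (fun z => ENNReal.ofReal (‖z‖ ^ (-(2 : ℝ)))) (y - z) *
      ‖u z‖ₑ) volume := by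
  have h : AEMeasurable (fun q : EuclideanSpace ℝ (Fin 3) × EuclideanSpace ℝ (Fin 3) =>
      S.indicator (fun z => ENNReal.ofReal (‖z‖ ^ (-(2 : ℝ)))) (q.1 - q.2) * ‖u q.2‖ₑ)
      (volume.prod volume) :=
    ((measurable_kernelMajorant.indicator hS).comp (measurable_fst.sub measurable_snd))
      |>.aemeasurable.mul hu.enorm.comp_snd
  exact h.lintegral_prod_right'

/-- The scale bookkeeping: `R⁻¹ (R^{3-2p})^{1/p} (R³)^{(p-1)/p} = 1`. [folklore] -/
theorem scale_rpow_cancel {R p : ℝ} (hR : 0 < R) (hp : 1 < p) :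
    R⁻¹ * (R ^ (3 - 2 * p)) ^ (1 / p) * (R ^ (3 : ℕ)) ^ (1 / (p / (p - 1))) = 1 := by
  have hp0 : p ≠ 0 := by positivity
  have hp1 : p - 1 ≠ 0 := sub_ne_zero.2 hp.ne'
  rw [← Real.rpow_natCast R 3, ← Real.rpow_mul hR.le, ← Real.rpow_mul hR.le, ← Real.rpow_neg_one,
    ← Real.rpow_add hR, ← Real.rpow_add hR]
  have : (-1 : ℝ) + (3 - 2 * p) * (1 / p) + ((3 : ℕ) : ℝ) * (1 / (p / (p - 1))) = 0 := by
    push_cast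
    field_simp
    ring
  rw [this, Real.rpow_zero]

/-- **The `L^p` bound, `2 ≤ p < ∞`.** If `|φ| ≤ R⁻¹|u|` pointwise with `u` vanishing off
`B(0, 2R)`, then `‖∫ φ(z) ∇Γ(· − z) dz‖_p ≤ C_p ‖u‖_p` with
`C_p = (4π)⁻¹ (3|B₁| + (3|B₁|/(2p−3))^{1/p} (8|B₁|)^{1-1/p})`, independent of `R`
(Young's inequality on the two pieces of `|z|⁻²`, Hölder for `‖u‖₁`). [cite: RobinsonRodrigoSadowskiCUP2016, Thm. A.10] -/
theorem lintegral_rpow_potential_le {E' : Type*} [NormedAddCommGroup E'] {p : ℝ} (hp : 2 ≤ p)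
    {R : ℝ} (hR : 0 < R) {φ : EuclideanSpace ℝ (Fin 3) → ℝ} {u : EuclideanSpace ℝ (Fin 3) → E'}
    (hu : AEStronglyMeasurable u volume) (hφu : ∀ z, |φ z| ≤ R⁻¹ * ‖u z‖)
    (hu0 : ∀ z, 2 * R ≤ ‖z‖ → u z = 0) :
    (∫⁻ y, ‖∫ z, φ z • gradient newtonKernel (y - z)‖ₑ ^ p) ^ (1 / p) ≤
      ENNReal.ofReal ((4 * Real.pi)⁻¹ *
        (3 * (volume : Measure (EuclideanSpace ℝ (Fin 3))).real (ball 0 1) +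
          (3 * (volume : Measure (EuclideanSpace ℝ (Fin 3))).real (ball 0 1) / (2 * p - 3)) ^
              (1 / p) *
            (8 * (volume : Measure (EuclideanSpace ℝ (Fin 3))).real (ball 0 1)) ^
              (1 / (p / (p - 1))))) *
        (∫⁻ z, ‖u z‖ₑ ^ p) ^ (1 / p) := by
  set V₁ : ℝ := (volume : Measure (EuclideanSpace ℝ (Fin 3))).real (ball 0 1) with hV₁
  have hV₁0 : 0 ≤ V₁ := measureReal_nonneg
  have hp1 : 1 ≤ p := by linarith
  have hp1' : 1 < p := by linarith
  have hp0 : 0 < p := by linarith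
  have hp32 : 3 / 2 < p := by linarith
  have h2p3 : 0 < 2 * p - 3 := by linarith
  set K : EuclideanSpace ℝ (Fin 3) → ℝ≥0∞ := fun z => ENNReal.ofReal (‖z‖ ^ (-(2 : ℝ))) with hK
  set K₁ : EuclideanSpace ℝ (Fin 3) → ℝ≥0∞ := (ball (0 : EuclideanSpace ℝ (Fin 3)) R).indicator K
    with hK₁
  set K₂ : EuclideanSpace ℝ (Fin 3) → ℝ≥0∞ := (ball (0 : EuclideanSpace ℝ (Fin 3)) R)ᶜ.indicator K
    with hK₂
  have hK₁m : Measurable K₁ := measurable_kernelMajorant.indicator measurableSet_ball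
  have hK₂m : Measurable K₂ := measurable_kernelMajorant.indicator measurableSet_ball.compl
  set I₁ : EuclideanSpace ℝ (Fin 3) → ℝ≥0∞ := fun y => ∫⁻ z, K₁ (y - z) * ‖u z‖ₑ with hI₁
  set I₂ : EuclideanSpace ℝ (Fin 3) → ℝ≥0∞ := fun y => ∫⁻ z, K₂ (y - z) * ‖u z‖ₑ with hI₂
  have hI₁m : AEMeasurable I₁ volume :=
    aemeasurable_lintegral_indicator_kernelMajorant hu measurableSet_ball
  have hI₂m : AEMeasurable I₂ volume :=
    aemeasurable_lintegral_indicator_kernelMajorant hu measurableSet_ball.compl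
  set c : ℝ≥0∞ := ENNReal.ofReal ((4 * Real.pi)⁻¹ * R⁻¹) with hc
  set N : ℝ≥0∞ := (∫⁻ z, ‖u z‖ₑ ^ p) ^ (1 / p) with hN
  -- pointwise majorisation
  have hpt : ∀ y, ‖∫ z, φ z • gradient newtonKernel (y - z)‖ₑ ≤ c * (I₁ y + I₂ y) := by
    intro y
    have h := enorm_potential_le hR hφu y
    rwa [lintegral_kernelMajorant_mul_eq_add R hu y] at h
  -- Step 1: pull out the constant
  have h1 : (∫⁻ y, ‖∫ z, φ z • gradient newtonKernel (y - z)‖ₑ ^ p) ^ (1 / p) ≤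
      c * (∫⁻ y, (I₁ + I₂) y ^ p) ^ (1 / p) := by
    calc (∫⁻ y, ‖∫ z, φ z • gradient newtonKernel (y - z)‖ₑ ^ p) ^ (1 / p)
        ≤ (∫⁻ y, (c * (I₁ y + I₂ y)) ^ p) ^ (1 / p) :=
          ENNReal.rpow_le_rpow (lintegral_mono fun y => ENNReal.rpow_le_rpow (hpt y) hp0.le)
            (by positivity)
      _ = (c ^ p * ∫⁻ y, (I₁ + I₂) y ^ p) ^ (1 / p) := by
          congr 1
          rw [← lintegral_const_mul' _ _ (ENNReal.rpow_ne_top_of_nonneg hp0.le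
            ENNReal.ofReal_ne_top)]
          refine lintegral_congr fun y => ?_
          rw [ENNReal.mul_rpow_of_nonneg _ _ hp0.le, Pi.add_apply]
      _ = c * (∫⁻ y, (I₁ + I₂) y ^ p) ^ (1 / p) := by
          rw [ENNReal.mul_rpow_of_nonneg _ _ (by positivity), ← ENNReal.rpow_mul,
            mul_one_div_cancel hp0.ne', ENNReal.rpow_one]
  -- Step 2: Minkowski
  have h2 : (∫⁻ y, (I₁ + I₂) y ^ p) ^ (1 / p) ≤
      (∫⁻ y, I₁ y ^ p) ^ (1 / p) + (∫⁻ y, I₂ y ^ p) ^ (1 / p) :=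
    ENNReal.lintegral_Lp_add_le hI₁m hI₂m hp1
  -- Step 3: Young for the near piece (`L¹ × L^p → L^p`)
  have h3 : (∫⁻ y, I₁ y ^ p) ^ (1 / p) ≤ ENNReal.ofReal (3 * V₁ * R) * N := by
    have hy := lintegral_rpow_lintegral_sub_mul_le_young (μ := (volume : Measure
      (EuclideanSpace ℝ (Fin 3)))) (K := K₁) (Φ := fun z => ‖u z‖ₑ) hK₁m.aemeasurable hu.enorm
      (b := 1) (m := p) (r := p) le_rfl hp1 hp0 (by rw [div_one])
    have e1 : ∫⁻ y, K₁ y ^ (1 : ℝ) = ENNReal.ofReal (3 * V₁ * R) := by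
      simp_rw [ENNReal.rpow_one]
      exact lintegral_indicator_ball_kernelMajorant hR
    rw [e1, div_one, div_self hp0.ne', ENNReal.rpow_one] at hy
    calc (∫⁻ y, I₁ y ^ p) ^ (1 / p)
        ≤ (ENNReal.ofReal (3 * V₁ * R) ^ p * ∫⁻ y, ‖u y‖ₑ ^ p) ^ (1 / p) :=
          ENNReal.rpow_le_rpow hy (by positivity)
      _ = ENNReal.ofReal (3 * V₁ * R) * N := by
          rw [ENNReal.mul_rpow_of_nonneg _ _ (by positivity), ← ENNReal.rpow_mul,
            mul_one_div_cancel hp0.ne', ENNReal.rpow_one]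
  -- Step 4: Young for the far piece (`L^p × L¹ → L^p`)
  have h4 : (∫⁻ y, I₂ y ^ p) ^ (1 / p) ≤
      (ENNReal.ofReal (3 * V₁ * (R ^ (3 - 2 * p) / (2 * p - 3)))) ^ (1 / p) * ∫⁻ z, ‖u z‖ₑ := by
    have hy := lintegral_rpow_lintegral_sub_mul_le_young (μ := (volume : Measure
      (EuclideanSpace ℝ (Fin 3)))) (K := K₂) (Φ := fun z => ‖u z‖ₑ) hK₂m.aemeasurable hu.enorm
      (b := p) (m := 1) (r := p) hp1 le_rfl hp0 (by rw [div_one, add_comm])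
    rw [lintegral_indicator_compl_ball_kernelMajorant_rpow hR hp32, div_self hp0.ne',
      ENNReal.rpow_one, div_one] at hy
    simp_rw [ENNReal.rpow_one] at hy
    calc (∫⁻ y, I₂ y ^ p) ^ (1 / p)
        ≤ (ENNReal.ofReal (3 * V₁ * (R ^ (3 - 2 * p) / (2 * p - 3))) * (∫⁻ y, ‖u y‖ₑ) ^ p) ^
            (1 / p) := ENNReal.rpow_le_rpow hy (by positivity)
      _ = (ENNReal.ofReal (3 * V₁ * (R ^ (3 - 2 * p) / (2 * p - 3)))) ^ (1 / p) *
            ∫⁻ z, ‖u z‖ₑ := by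
          rw [ENNReal.mul_rpow_of_nonneg _ _ (by positivity), ← ENNReal.rpow_mul,
            mul_one_div_cancel hp0.ne', ENNReal.rpow_one]
  -- Step 5: `‖u‖₁ ≤ ‖u‖_p |B(0,2R)|^{1/p'}`
  have hpp' : p.HolderConjugate (p / (p - 1)) := Real.HolderConjugate.conjExponent hp1'
  have h5 := lintegral_enorm_le_of_eq_zero_off_ball hu hu0 hpp'
  have hvol : volume (ball (0 : EuclideanSpace ℝ (Fin 3)) (2 * R)) =
      ENNReal.ofReal (V₁ * R ^ (3 : ℕ) * 8) := by
    rw [Measure.addHaar_ball_of_pos _ _ (by positivity : (0 : ℝ) < 2 * R),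
      finrank_euclideanSpace_fin, hV₁, ← ENNReal.ofReal_toReal measure_ball_lt_top.ne,
      ← ENNReal.ofReal_mul (by positivity)]
    congr 1
    rw [Measure.real]
    ring
  rw [hvol] at h5
  -- Step 6: assemble
  set a₁ : ℝ := 3 * V₁ * R with ha₁
  set a₂ : ℝ := 3 * V₁ * (R ^ (3 - 2 * p) / (2 * p - 3)) with ha₂
  set v : ℝ := V₁ * R ^ (3 : ℕ) * 8 with hv
  have ha₁0 : 0 ≤ a₁ := by positivity
  have ha₂0 : 0 ≤ a₂ := by
    rw [ha₂]
    exact mul_nonneg (by positivity) (div_nonneg (Real.rpow_nonneg hR.le _) h2p3.le)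
  have hv0 : 0 ≤ v := by positivity
  have key : (∫⁻ y, ‖∫ z, φ z • gradient newtonKernel (y - z)‖ₑ ^ p) ^ (1 / p) ≤
      (c * ENNReal.ofReal a₁ + c * ENNReal.ofReal a₂ ^ (1 / p) *
        ENNReal.ofReal v ^ (1 / (p / (p - 1)))) * N := by
    calc (∫⁻ y, ‖∫ z, φ z • gradient newtonKernel (y - z)‖ₑ ^ p) ^ (1 / p)
        ≤ c * ((∫⁻ y, I₁ y ^ p) ^ (1 / p) + (∫⁻ y, I₂ y ^ p) ^ (1 / p)) :=
          h1.trans (mul_le_mul' le_rfl h2)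
      _ ≤ c * (ENNReal.ofReal a₁ * N +
          ENNReal.ofReal a₂ ^ (1 / p) * (N * ENNReal.ofReal v ^ (1 / (p / (p - 1))))) :=
          mul_le_mul' le_rfl (add_le_add h3 (h4.trans (mul_le_mul' le_rfl h5)))
      _ = (c * ENNReal.ofReal a₁ + c * ENNReal.ofReal a₂ ^ (1 / p) *
          ENNReal.ofReal v ^ (1 / (p / (p - 1)))) * N := by ring
  refine key.trans (le_of_eq ?_)
  congr 1
  -- the constant, in real form
  have hexp : 0 ≤ 1 / (p / (p - 1)) := by positivity
  rw [ENNReal.ofReal_rpow_of_nonneg ha₂0 (by positivity), ENNReal.ofReal_rpow_of_nonneg hv0 hexp,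
    hc, ← ENNReal.ofReal_mul (by positivity), ← ENNReal.ofReal_mul (by positivity),
    ← ENNReal.ofReal_mul (by positivity), ← ENNReal.ofReal_add (by positivity) (by positivity)]
  congr 1
  have hsc := scale_rpow_cancel hR hp1'
  have e2 : a₂ ^ (1 / p) = (3 * V₁ / (2 * p - 3)) ^ (1 / p) * (R ^ (3 - 2 * p)) ^ (1 / p) := by
    rw [ha₂, ← Real.mul_rpow (by positivity) (Real.rpow_nonneg hR.le _)]
    congr 1
    ring
  have e3 : v ^ (1 / (p / (p - 1))) =
      (8 * V₁) ^ (1 / (p / (p - 1))) * (R ^ (3 : ℕ)) ^ (1 / (p / (p - 1))) := by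
    rw [hv, ← Real.mul_rpow (by positivity) (by positivity)]
    congr 1
    ring
  rw [e2, e3, ha₁]
  calc (4 * Real.pi)⁻¹ * R⁻¹ * (3 * V₁ * R) +
        (4 * Real.pi)⁻¹ * R⁻¹ * ((3 * V₁ / (2 * p - 3)) ^ (1 / p) * (R ^ (3 - 2 * p)) ^ (1 / p)) *
          ((8 * V₁) ^ (1 / (p / (p - 1))) * (R ^ (3 : ℕ)) ^ (1 / (p / (p - 1))))
      = (4 * Real.pi)⁻¹ * (3 * V₁) * (R⁻¹ * R) +
        (4 * Real.pi)⁻¹ * ((3 * V₁ / (2 * p - 3)) ^ (1 / p) * (8 * V₁) ^ (1 / (p / (p - 1)))) *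
          (R⁻¹ * (R ^ (3 - 2 * p)) ^ (1 / p) * (R ^ (3 : ℕ)) ^ (1 / (p / (p - 1)))) := by ring
    _ = _ := by rw [hsc, inv_mul_cancel₀ hR.ne']; ring

/-! ### The `L^∞` bound and the bound for all `2 ≤ q ≤ ∞` -/

/-- **The `L^∞` bound.** If `|φ| ≤ R⁻¹|u|` with `u` vanishing off `B(0, 2R)`, then
`‖∫ φ(z) ∇Γ(· − z) dz‖_∞ ≤ (4π)⁻¹ (3|B₁| + 8|B₁|) ‖u‖_∞`
(`∫_{|z|<R}|z|⁻² = 4πR`, `|z|⁻² ≤ R⁻²` off `B_R` and `‖u‖₁ ≤ |B_{2R}| ‖u‖_∞`). [folklore] -/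
theorem eLpNormEssSup_potential_le {E' : Type*} [NormedAddCommGroup E'] {R : ℝ} (hR : 0 < R)
    {φ : EuclideanSpace ℝ (Fin 3) → ℝ} {u : EuclideanSpace ℝ (Fin 3) → E'}
    (hu : AEStronglyMeasurable u volume) (hφu : ∀ z, |φ z| ≤ R⁻¹ * ‖u z‖)
    (hu0 : ∀ z, 2 * R ≤ ‖z‖ → u z = 0) :
    eLpNormEssSup (fun y => ∫ z, φ z • gradient newtonKernel (y - z)) volume ≤
      ENNReal.ofReal ((4 * Real.pi)⁻¹ *
        (3 * (volume : Measure (EuclideanSpace ℝ (Fin 3))).real (ball 0 1) +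
          8 * (volume : Measure (EuclideanSpace ℝ (Fin 3))).real (ball 0 1))) *
        eLpNormEssSup u volume := by
  set V₁ : ℝ := (volume : Measure (EuclideanSpace ℝ (Fin 3))).real (ball 0 1) with hV₁
  have hV₁0 : 0 ≤ V₁ := measureReal_nonneg
  set K : EuclideanSpace ℝ (Fin 3) → ℝ≥0∞ := fun z => ENNReal.ofReal (‖z‖ ^ (-(2 : ℝ))) with hK
  set K₁ : EuclideanSpace ℝ (Fin 3) → ℝ≥0∞ := (ball (0 : EuclideanSpace ℝ (Fin 3)) R).indicator K
    with hK₁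
  set K₂ : EuclideanSpace ℝ (Fin 3) → ℝ≥0∞ := (ball (0 : EuclideanSpace ℝ (Fin 3)) R)ᶜ.indicator K
    with hK₂
  have hK₁m : Measurable K₁ := measurable_kernelMajorant.indicator measurableSet_ball
  set M : ℝ≥0∞ := eLpNormEssSup u volume with hM
  set c : ℝ≥0∞ := ENNReal.ofReal ((4 * Real.pi)⁻¹ * R⁻¹) with hc
  have hae : ∀ᵐ z ∂(volume : Measure (EuclideanSpace ℝ (Fin 3))), ‖u z‖ₑ ≤ M :=
    enorm_ae_le_eLpNormEssSup u volume
  -- the near piece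
  have h1 : ∀ y, ∫⁻ z, K₁ (y - z) * ‖u z‖ₑ ≤ ENNReal.ofReal (3 * V₁ * R) * M := by
    intro y
    calc ∫⁻ z, K₁ (y - z) * ‖u z‖ₑ ≤ ∫⁻ z, K₁ (y - z) * M :=
          lintegral_mono_ae (hae.mono fun z hz => mul_le_mul' le_rfl hz)
      _ = (∫⁻ z, K₁ (y - z)) * M := by
          exact lintegral_mul_const M
            (show Measurable fun z => K₁ (y - z) from
              hK₁m.comp (measurable_const.sub measurable_id))
      _ = ENNReal.ofReal (3 * V₁ * R) * M := by
          rw [lintegral_sub_left_eq_self K₁ y, hK₁, lintegral_indicator_ball_kernelMajorant hR]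
  -- the far piece
  have hK₂le : ∀ x, K₂ x ≤ ENNReal.ofReal (R ^ (-(2 : ℝ))) := by
    intro x
    by_cases hx : x ∈ (ball (0 : EuclideanSpace ℝ (Fin 3)) R)ᶜ
    · rw [hK₂, indicator_of_mem hx, hK]
      refine ENNReal.ofReal_le_ofReal ?_
      rw [mem_compl_iff, mem_ball_zero_iff, not_lt] at hx
      exact Real.rpow_le_rpow_of_nonpos hR hx (by norm_num)
    · rw [hK₂, indicator_of_notMem hx]
      exact zero_le
  have hvol : volume (ball (0 : EuclideanSpace ℝ (Fin 3)) (2 * R)) =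
      ENNReal.ofReal (V₁ * R ^ (3 : ℕ) * 8) := by
    rw [Measure.addHaar_ball_of_pos _ _ (by positivity : (0 : ℝ) < 2 * R),
      finrank_euclideanSpace_fin, hV₁, ← ENNReal.ofReal_toReal measure_ball_lt_top.ne,
      ← ENNReal.ofReal_mul (by positivity)]
    congr 1
    rw [Measure.real]
    ring
  have hu1 : ∫⁻ z, ‖u z‖ₑ ≤ M * ENNReal.ofReal (V₁ * R ^ (3 : ℕ) * 8) := by
    have e : (fun z => ‖u z‖ₑ) = (ball (0 : EuclideanSpace ℝ (Fin 3)) (2 * R)).indicator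
        fun z => ‖u z‖ₑ := by
      funext z
      by_cases hz : z ∈ ball (0 : EuclideanSpace ℝ (Fin 3)) (2 * R)
      · rw [indicator_of_mem hz]
      · rw [indicator_of_notMem hz, hu0 z (not_lt.1 (by rwa [mem_ball_zero_iff] at hz)),
          enorm_zero]
    calc ∫⁻ z, ‖u z‖ₑ = ∫⁻ z in ball (0 : EuclideanSpace ℝ (Fin 3)) (2 * R), ‖u z‖ₑ := by
          rw [← lintegral_indicator measurableSet_ball, ← e]
      _ ≤ ∫⁻ z in ball (0 : EuclideanSpace ℝ (Fin 3)) (2 * R), M :=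
          lintegral_mono_ae (ae_restrict_of_ae hae)
      _ = M * ENNReal.ofReal (V₁ * R ^ (3 : ℕ) * 8) := by
          rw [setLIntegral_const, hvol]
  have h2 : ∀ y, ∫⁻ z, K₂ (y - z) * ‖u z‖ₑ ≤
      ENNReal.ofReal (R ^ (-(2 : ℝ))) * (M * ENNReal.ofReal (V₁ * R ^ (3 : ℕ) * 8)) := by
    intro y
    calc ∫⁻ z, K₂ (y - z) * ‖u z‖ₑ ≤ ∫⁻ z, ENNReal.ofReal (R ^ (-(2 : ℝ))) * ‖u z‖ₑ :=
          lintegral_mono fun z => mul_le_mul' (hK₂le _) le_rfl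
      _ = ENNReal.ofReal (R ^ (-(2 : ℝ))) * ∫⁻ z, ‖u z‖ₑ := by
          rw [lintegral_const_mul' _ _ ENNReal.ofReal_ne_top]
      _ ≤ _ := mul_le_mul' le_rfl hu1
  -- pointwise bound and conclusion
  have hpt : ∀ y, ‖∫ z, φ z • gradient newtonKernel (y - z)‖ₑ ≤
      c * (ENNReal.ofReal (3 * V₁ * R) * M +
        ENNReal.ofReal (R ^ (-(2 : ℝ))) * (M * ENNReal.ofReal (V₁ * R ^ (3 : ℕ) * 8))) := by
    intro y
    have h := enorm_potential_le hR hφu y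
    rw [lintegral_kernelMajorant_mul_eq_add R hu y] at h
    exact h.trans (mul_le_mul' le_rfl (add_le_add (h1 y) (h2 y)))
  have hconst : c * (ENNReal.ofReal (3 * V₁ * R) * M +
      ENNReal.ofReal (R ^ (-(2 : ℝ))) * (M * ENNReal.ofReal (V₁ * R ^ (3 : ℕ) * 8))) =
      ENNReal.ofReal ((4 * Real.pi)⁻¹ * (3 * V₁ + 8 * V₁)) * M := by
    have hR2 : 0 ≤ R ^ (-(2 : ℝ)) := Real.rpow_nonneg hR.le _
    calc c * (ENNReal.ofReal (3 * V₁ * R) * M +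
          ENNReal.ofReal (R ^ (-(2 : ℝ))) * (M * ENNReal.ofReal (V₁ * R ^ (3 : ℕ) * 8)))
        = (c * ENNReal.ofReal (3 * V₁ * R) +
            c * ENNReal.ofReal (R ^ (-(2 : ℝ))) * ENNReal.ofReal (V₁ * R ^ (3 : ℕ) * 8)) * M := by
          ring
      _ = ENNReal.ofReal ((4 * Real.pi)⁻¹ * (3 * V₁ + 8 * V₁)) * M := by
          rw [hc, ← ENNReal.ofReal_mul (by positivity), ← ENNReal.ofReal_mul (by positivity),
            ← ENNReal.ofReal_mul (by positivity), ← ENNReal.ofReal_add (by positivity)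
              (by positivity)]
          congr 2
          rw [Real.rpow_neg hR.le, show (2 : ℝ) = ((2 : ℕ) : ℝ) by norm_num, Real.rpow_natCast]
          field_simp
  refine eLpNormEssSup_le_of_ae_enorm_bound (Eventually.of_forall fun y => ?_)
  rw [← hconst]
  exact hpt y

/-- **Scale-invariant `L^q` bound for the gradient-Newtonian potential, `2 ≤ q ≤ ∞`.** For
every `q ∈ [2, ∞]` there is `C = C(q)` such that for all `R > 0`, all `φ : ℝ³ → ℝ` and all `u`
with `|φ| ≤ R⁻¹ |u|` and `u = 0` off `B(0, 2R)`:
`‖∫ φ(z) ∇Γ(· − z) dz‖_{L^q} ≤ C ‖u‖_{L^q}` (the substitute, with constant uniform in `R`, for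
the Calderón–Zygmund step "`‖w‖_{L^q} ≤ c_q ‖ξU₀‖_{L^q}`" of the proof of [BT1] Lemma 2.5).
[cite: BradshawTsai2017AHP, proof of Lemma 2.5] -/
theorem exists_eLpNorm_potential_le (E' : Type*) [NormedAddCommGroup E'] {q : ℝ≥0∞}
    (hq : 2 ≤ q) :
    ∃ C : ℝ≥0, ∀ ⦃R : ℝ⦄, 0 < R →
      ∀ ⦃φ : EuclideanSpace ℝ (Fin 3) → ℝ⦄ ⦃u : EuclideanSpace ℝ (Fin 3) → E'⦄,
        AEStronglyMeasurable u volume → (∀ z, |φ z| ≤ R⁻¹ * ‖u z‖) →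
        (∀ z, 2 * R ≤ ‖z‖ → u z = 0) →
        eLpNorm (fun y => ∫ z, φ z • gradient newtonKernel (y - z)) q volume ≤
          C * eLpNorm u q volume := by
  set V₁ : ℝ := (volume : Measure (EuclideanSpace ℝ (Fin 3))).real (ball 0 1) with hV₁
  by_cases hqtop : q = ⊤
  · refine ⟨((4 * Real.pi)⁻¹ * (3 * V₁ + 8 * V₁)).toNNReal, fun R hR φ u hu hφu hu0 => ?_⟩
    rw [hqtop, eLpNorm_exponent_top, eLpNorm_exponent_top]
    exact eLpNormEssSup_potential_le hR hu hφu hu0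
  · have hq0 : q ≠ 0 := (lt_of_lt_of_le (by norm_num) hq).ne'
    set p : ℝ := q.toReal with hp
    have hp2 : 2 ≤ p := by
      have := (ENNReal.toReal_le_toReal (by norm_num) hqtop).2 hq
      simpa using this
    refine ⟨((4 * Real.pi)⁻¹ * (3 * V₁ + (3 * V₁ / (2 * p - 3)) ^ (1 / p) *
      (8 * V₁) ^ (1 / (p / (p - 1))))).toNNReal, fun R hR φ u hu hφu hu0 => ?_⟩
    rw [eLpNorm_eq_lintegral_rpow_enorm_toReal hq0 hqtop,
      eLpNorm_eq_lintegral_rpow_enorm_toReal hq0 hqtop]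
    exact lintegral_rpow_potential_le hp2 hR hu hφu hu0

end NewtonGradPotential

end Literature.Analysis.FluidPDE

end
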